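import Summits.QuantumFields.YangMills.Theorems.LangevinControlUVFemtoCurvatureTwoPointCDefs
import Summits.QuantumFields.YangMills.Theorems.LangevinControlUVFemtoCurvatureTwoPointCStubUnitMap
import Summits.QuantumFields.YangMills.Theorems.LangevinControlUVFemtoCurvatureTwoPointCStubPackageOfUnitMap

/-!
# Route `LangevinControlUV`, crux `FemtoCurvatureTwoPointC` (stmt-QuantumFields-16204): the reduction of line `Sketch`

`cruxCAt_of_afCouplingAt : AFCouplingAt r → CruxCAt r` for EVERY compact group `G` (any Borel structure) and every
lattice representation `r` (no simplicity, no faithfulness needed: pure bookkeeping), and its universal closure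
`femtoCurvatureTwoPointC_of_afCoupling : AFCoupling → FemtoCurvatureTwoPointC` — the crux in continuous intrinsic
units follows from ONE physics statement, an admissible finite-volume coupling with the asymptotic-freedom step law
matched per datum to the curvature two-point function (`…FemtoCurvatureTwoPointCDefs`). The two real-analysis inputs are
the landed stubs `stub_unitMap` (E-a: window ⇒ continuous unit map pinned to the exit) and `stub_packageOfUnitMap`
(E-b: IR-anchored envelopes ⇒ the `Γ`-clauses). This file is the sorry-free part of the registered skeleton
`Cruxes/FemtoCurvatureTwoPointC/Lines/Sketch.lean` (composition `FemtoCurvatureTwoPointC_of`), with the open stub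
`stub_afCoupling` turned into the hypothesis `AFCouplingAt r`.

Deliberately NOT here: any claim about `AFCouplingAt` itself (open; crux-sized).
-/

set_option autoImplicit false

noncomputable section

open Filter Topology MeasureTheory
open Literature.MathematicalPhysics.QuantumFieldTheory

namespace Summit.QuantumFields.YangMills.Theorems.FemtoCurvatureTwoPointC

/-! ## Glue: torus distance bounds -/

/-- On the discrete torus `(ℤ/L)⁴`, two distinct sites are at Euclidean (minimal-representative) distance `≥ 1`. -/
theorem one_le_torusDist {L : ℕ} (x y : Fin 4 → ZMod L) (hxy : x ≠ y) :
    (1 : ℝ) ≤ Real.sqrt (∑ k : Fin 4, (((x k - y k).valMinAbs : ℤ) : ℝ) ^ 2) := by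
  obtain ⟨k, hk⟩ : ∃ k, x k ≠ y k := by
    by_contra h
    push Not at h
    exact hxy (funext h)
  have hne : (x k - y k).valMinAbs ≠ 0 := by
    rw [Ne, ZMod.valMinAbs_eq_zero]
    exact sub_ne_zero.mpr hk
  have h1 : (1 : ℝ) ≤ (((x k - y k).valMinAbs : ℤ) : ℝ) ^ 2 := by
    have : (1 : ℤ) ≤ ((x k - y k).valMinAbs) ^ 2 := by
      have habs : (1 : ℤ) ≤ |(x k - y k).valMinAbs| := Int.one_le_abs hne
      nlinarith [abs_nonneg ((x k - y k).valMinAbs), sq_abs ((x k - y k).valMinAbs)]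
    exact_mod_cast this
  have hle : (((x k - y k).valMinAbs : ℤ) : ℝ) ^ 2 ≤
      ∑ k : Fin 4, (((x k - y k).valMinAbs : ℤ) : ℝ) ^ 2 :=
    Finset.single_le_sum (f := fun k => (((x k - y k).valMinAbs : ℤ) : ℝ) ^ 2)
      (fun i _ => sq_nonneg _) (Finset.mem_univ k)
  rw [show (1 : ℝ) = Real.sqrt 1 by simp]
  exact Real.sqrt_le_sqrt (h1.trans hle)

/-- On the discrete torus `(ℤ/L)⁴`, `L ≥ 1`, the Euclidean (minimal-representative) distance is `≤ L`. -/
theorem torusDist_le {L : ℕ} [NeZero L] (x y : Fin 4 → ZMod L) :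
    Real.sqrt (∑ k : Fin 4, (((x k - y k).valMinAbs : ℤ) : ℝ) ^ 2) ≤ L := by
  have hLpos : (0 : ℝ) ≤ L := Nat.cast_nonneg L
  have hterm : ∀ k : Fin 4, (((x k - y k).valMinAbs : ℤ) : ℝ) ^ 2 ≤ ((L : ℝ) / 2) ^ 2 := by
    intro k
    have hnat : ((x k - y k).valMinAbs).natAbs ≤ L / 2 := ZMod.natAbs_valMinAbs_le _
    have habs : |(((x k - y k).valMinAbs : ℤ) : ℝ)| ≤ (L : ℝ) / 2 := by
      have h1 : (((x k - y k).valMinAbs).natAbs : ℝ) ≤ ((L / 2 : ℕ) : ℝ) := by exact_mod_cast hnat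
      have h2 : ((L / 2 : ℕ) : ℝ) ≤ (L : ℝ) / 2 := Nat.cast_div_le
      rw [← Int.cast_abs, Int.abs_eq_natAbs, Int.cast_natCast]
      exact h1.trans h2
    calc (((x k - y k).valMinAbs : ℤ) : ℝ) ^ 2 = |(((x k - y k).valMinAbs : ℤ) : ℝ)| ^ 2 := (sq_abs _).symm
      _ ≤ ((L : ℝ) / 2) ^ 2 := pow_le_pow_left₀ (abs_nonneg _) habs 2
  have hsum : ∑ k : Fin 4, (((x k - y k).valMinAbs : ℤ) : ℝ) ^ 2 ≤ (L : ℝ) ^ 2 := by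
    calc ∑ k : Fin 4, (((x k - y k).valMinAbs : ℤ) : ℝ) ^ 2 ≤ ∑ _k : Fin 4, ((L : ℝ) / 2) ^ 2 :=
          Finset.sum_le_sum fun k _ => hterm k
      _ = (L : ℝ) ^ 2 := by simp [Finset.sum_const, Finset.card_univ, Fintype.card_fin]; ring
  calc Real.sqrt (∑ k : Fin 4, (((x k - y k).valMinAbs : ℤ) : ℝ) ^ 2) ≤ Real.sqrt ((L : ℝ) ^ 2) :=
        Real.sqrt_le_sqrt hsum
    _ = L := Real.sqrt_sq hLpos

/-! ## The reduction -/

/-- **Reduction at fixed data.** `AFCouplingAt r → CruxCAt r` for every compact group `G` and lattice representation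
`r`: the physics statement supplies the admissible coupling with the AF step law and the matchings; `stub_unitMap`
manufactures the continuous unit map pinned to the window exit; `stub_packageOfUnitMap` turns matching into the
two-sided `Γ`-clauses (abstract amplitude instantiated with `n⁸·Cov_{L,β}(P_0^{01},P_{ne₂}^{01})`, pair envelope composed
with pair matching via `1 ≤ dist ≤ L`). -/
theorem cruxCAt_of_afCouplingAt {G : Type} [Group G] [TopologicalSpace G] [IsTopologicalGroup G] [CompactSpace G]
    [MeasurableSpace G] [BorelSpace G] (r : LatticeRep G) (h : AFCouplingAt r) : CruxCAt r := by
  obtain ⟨u, u₀, β₀, κ₁, κ₂, κ₃, c, C, hu₀, hc, hκ₁, hκ₃, hpos, hcont, hfreeze, hcomp, hdy, hax, hpair⟩ := h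
  obtain ⟨a, β₁, ℓ₀, D, ha_cont, ha_pos, ha_lim, hℓ₀, hβ₁, hD, hpin⟩ :=
    stub_unitMap u u₀ β₀ κ₁ κ₂ κ₃ hu₀ hκ₁ hκ₃ hpos hcont hfreeze hcomp hdy
  -- the abstract axis amplitude (torus of side `M + 1`; side `0` carries the junk value `0`)
  let Pl : (M : ℕ) → (Fin 4 → ZMod (M + 1)) → Fin 4 → Fin 4 → GaugeConfig 4 (M + 1) G → ℝ :=
    fun M x i j U => (r.N : ℝ) - (r.ρ (plaquetteHolonomy U x i j)).trace.re
  let A : ℕ → ℝ → ℕ → ℝ := fun L β n =>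
    match L with
    | 0 => 0
    | M + 1 =>
      (n : ℝ) ^ 8 *
        (wilsonExpectation r.ρ β (fun U : GaugeConfig 4 (M + 1) G =>
            Pl M 0 0 1 U * Pl M (Pi.single (2 : Fin 4) ((n : ℕ) : ZMod (M + 1))) 0 1 U)
          - wilsonExpectation r.ρ β (fun U : GaugeConfig 4 (M + 1) G => Pl M 0 0 1 U)
            * wilsonExpectation r.ρ β (fun U : GaugeConfig 4 (M + 1) G =>
                Pl M (Pi.single (2 : Fin 4) ((n : ℕ) : ZMod (M + 1))) 0 1 U))
  have hA : ∀ (L : ℕ) (β : ℝ) (n : ℕ), β₀ ≤ β → 1 ≤ n → 8 * n ≤ L →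
      (∀ M : ℕ, 8 ≤ M → M ≤ L → u M β ≤ u₀) →
      c * u (8 * n) β ^ 2 ≤ A L β n ∧ A L β n ≤ C * u (8 * n) β ^ 2 := by
    intro L β n hβ hn hnL hwin
    obtain ⟨M, rfl⟩ : ∃ M, L = M + 1 := Nat.exists_eq_succ_of_ne_zero (by omega)
    exact hax (M + 1) β n hβ hn hnL hwin (Pl M) (fun F => wilsonExpectation r.ρ β F) rfl rfl
  obtain ⟨Γ, c', C', hc', hΓ, hbox⟩ :=
    stub_packageOfUnitMap u u₀ β₀ κ₁ κ₂ κ₃ c C a β₁ ℓ₀ D A hu₀ hκ₁ hκ₃ hc hℓ₀ hβ₁ hD ha_pos hpos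
      hcomp hdy hA hpin
  refine ⟨a, ha_cont, Γ, β₁, ℓ₀, c', C', hℓ₀, hc', ha_pos, ha_lim, hΓ, ?_⟩
  intro L _ β hβ hLa
  obtain ⟨hwin, haxis, hpairs⟩ := hbox L β hβ hLa
  have hβ₀ : β₀ ≤ β := hβ₁.trans hβ
  refine ⟨?_, ?_⟩
  · -- axis clause
    intro n hn hnL
    obtain ⟨M, rfl⟩ : ∃ M, L = M + 1 := Nat.exists_eq_succ_of_ne_zero (NeZero.ne L)
    exact haxis n hn hnL
  · -- pair clause
    intro x y i j i' j' hxy hij hij'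
    have h1 := hpair L β hβ₀ hwin (fun x i j U => (r.N : ℝ) - (r.ρ (plaquetteHolonomy U x i j)).trace.re)
      (fun F => wilsonExpectation r.ρ β F) rfl rfl x y i j i' j' hxy hij hij'
    have hd1 := one_le_torusDist x y hxy
    have hdL := torusDist_le x y
    have h2 := hpairs (Real.sqrt (∑ k : Fin 4, (((x k - y k).valMinAbs : ℤ) : ℝ) ^ 2)) hd1 hdL
    refine h1.trans (le_trans ?_ h2)
    exact mul_le_mul_of_nonneg_right (le_max_left C 0) (sq_nonneg _)

/-- **Reduction (universal closure).** `AFCoupling → FemtoCurvatureTwoPointC`: the crux in continuous intrinsic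
units follows from the line's one physics statement; simplicity of `G` and faithfulness of `r` are not used by the
bookkeeping (they matter only for the truth of `AFCoupling`). -/
theorem femtoCurvatureTwoPointC_of_afCoupling (h : AFCoupling) :
    Summit.QuantumFields.YangMills.Theses.LangevinControlUV.FemtoCurvatureTwoPointC := by
  rw [femtoCurvatureTwoPointC_iff]
  intro G _ _ _ _ hG
  letI : MeasurableSpace G := borel G
  haveI : BorelSpace G := ⟨rfl⟩
  intro r
  exact cruxCAt_of_afCouplingAt r (h G hG r)

end Summit.QuantumFields.YangMills.Theorems.FemtoCurvatureTwoPointC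

end
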